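import Mathlib
import Literature.Analysis.FluidPDE.VectorCalculus
import Literature.Analysis.FluidPDE.ClassicalSolutionRegion
import Literature.Analysis.FluidPDE.AncientMildOfClassical
import Literature.Analysis.FluidPDE.WholeSpaceIBP
import Literature.Analysis.FluidPDE.SelfSimilar
import Summits.NavierStokesRegularity.NavierStokesRegularity.Theses.ThreadingFlux
import HarnessLib

/-!
# `PoloidalLiouville` ⟨1222⟩ — boundedness is load-bearing (negation lens, kernel-checked)

Crux workfile for `stmt-NavierStokesRegularity-1222`
(`Summit.NavierStokesRegularity.NavierStokesRegularity.Theses.ThreadingFlux.PoloidalLiouville`),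
ns-idea-15 g8 (lens «negation»), companion of `SilentShellsSketch.lean` / card `Ideas/silent-shells.md`.

A `Negative/`-style entry must negate a HYPOTHESIS-DROPPED VARIANT OF `PoloidalLiouville` ITSELF
(critic ns-wall-crit-1, V21-P1).  The one hypothesis of `PoloidalLiouville` that can be dropped while
keeping the Navier–Stokes equations is BOUNDEDNESS: `IsBoundedAncientMildSolution 1 v` packs the mild
(Oseen–Duhamel) equations together with `v ∈ L^∞((−∞,0) × ℝ³)`.  Replacing it by "classical solution
of unforced NS with viscosity 1 on `(−∞,0) × ℝ³` with some pressure" (`IsClassicalNSSolutionOn (Iio 0)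
1 0 v p`, tree) and keeping every other hypothesis verbatim gives `PoloidalLiouvilleWithoutBounded`.

* `poloidalLiouvilleClassicalBounded_of` — restoring boundedness (of `v` and `p` on the past) turns
  the classical hypothesis back into `IsBoundedAncientMildSolution 1 v` by the tree bridge
  `IsClassicalNSSolutionOn.isAncientMildSolution_of_isBoundedOn` (Fabes–Jones–Rivière), so
  `PoloidalLiouville` implies the bounded classical variant `PoloidalLiouvilleClassicalBounded`.
* `poloidalLiouville_false_without_bounded : ¬ PoloidalLiouvilleWithoutBounded` — WITNESS: the free
  Poiseuille jet `v(t,x) = (x₀² + x₁²) e₂`, `p(t,x) = 4x₂` (any `t`): a steady, smooth, UNBOUNDED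
  classical Navier–Stokes solution on `ℝ³` (`(v·∇)v = 0`, `Δv = 4e₂ = ∇p`, `div v = 0`), POLOIDAL
  (axisymmetric about the `x₂`-axis, no swirl), ROTATIONAL (`curl v = (2x₁, −2x₀, 0) ≠ 0`, azimuthal,
  tangent to every sphere about every axis point: `⟪x, curl v x⟫ = 0`), and not constant.  So inside
  the exact shape class of W1 (sphere-tangent vorticity about a fixed centre, for all times) the
  Liouville conclusion fails as soon as boundedness is dropped: the wall ⟨1222⟩ is a statement about
  BOUNDED poloidal dynamics, not about poloidal structure alone.  (The irrotational strain `x ↦ Sx`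
  would also do; the jet is chosen because it carries non-zero sphere-tangent vorticity, i.e. it is
  unthreaded for the non-trivial reason.)

All kernel-checked, no `sorry`.  W1 movement 0; ⟨1222⟩ OPEN; NS regularity is NOT proved; this file
claims nothing about blow-up.
-/

noncomputable section

set_option linter.dupNamespace false

open Set Function MeasureTheory
open scoped ContDiff RealInnerProductSpace Laplacian Topology
open Literature.Analysis.FluidPDE

namespace Summit.NavierStokesRegularity.NavierStokesRegularity.Cruxes.PoloidalLiouville.SilentShells

local notation "E3" => EuclideanSpace ℝ (Fin 3)

/-! ## The two variants of `PoloidalLiouville` -/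

/-- `PoloidalLiouville` with BOUNDEDNESS DROPPED: the hypothesis `IsBoundedAncientMildSolution 1 v`
is replaced by "`(v, p)` is a classical solution of unforced Navier–Stokes (viscosity 1) on
`(−∞, 0) × ℝ³`"; every other hypothesis and the conclusion are verbatim those of
`Theses.ThreadingFlux.PoloidalLiouville`.  FALSE: `poloidalLiouville_false_without_bounded`. -/
def PoloidalLiouvilleWithoutBounded : Prop :=
  ∀ (v : ℝ → E3 → E3) (p : ℝ → E3 → ℝ), IsClassicalNSSolutionOn (Iio 0) 1 0 v p →
    (∀ t < 0, AEStronglyMeasurable (v t) volume) →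
    ContDiffOn ℝ (⊤ : ℕ∞) (uncurry v) (Iio 0 ×ˢ univ) →
    (∃ x₀ : E3, ∀ t < 0, ∀ x, ⟪x - x₀, curl (v t) x⟫ = 0) →
    ∀ t < 0, ∃ b : E3, ∀ x, v t x = b

/-- The same variant WITH boundedness of `v` and `p` on the past restored.  A consequence of
`PoloidalLiouville` (`poloidalLiouvilleClassicalBounded_of`). -/
def PoloidalLiouvilleClassicalBounded : Prop :=
  ∀ (v : ℝ → E3 → E3) (p : ℝ → E3 → ℝ), IsClassicalNSSolutionOn (Iio 0) 1 0 v p →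
    IsBoundedOn (Iio 0) v → IsBoundedOn (Iio 0) p →
    (∀ t < 0, AEStronglyMeasurable (v t) volume) →
    ContDiffOn ℝ (⊤ : ℕ∞) (uncurry v) (Iio 0 ×ˢ univ) →
    (∃ x₀ : E3, ∀ t < 0, ∀ x, ⟪x - x₀, curl (v t) x⟫ = 0) →
    ∀ t < 0, ∃ b : E3, ∀ x, v t x = b

/-- **Restoring boundedness recovers the crux's hypothesis**: a classical solution on the past,
bounded together with its pressure, is a bounded ancient mild solution (tree bridge
`IsClassicalNSSolutionOn.isAncientMildSolution_of_isBoundedOn`), so `PoloidalLiouville` ⟨1222⟩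
implies the bounded classical variant. -/
theorem poloidalLiouvilleClassicalBounded_of (h : Theses.ThreadingFlux.PoloidalLiouville) :
    PoloidalLiouvilleClassicalBounded := by
  intro v p hcl hbu hbp hmeas hsm hun
  have hmild : IsAncientMildSolution 1 v :=
    hcl.isAncientMildSolution_of_isBoundedOn one_pos
      (fun t ht => hbu.mono fun s hs => lt_of_le_of_lt hs ht)
      (fun t ht => hbp.mono fun s hs => lt_of_le_of_lt hs ht)
  exact h v ⟨hmild, hbu⟩ hmeas hsm hun

/-! ## The witness: the free Poiseuille jet `U(x) = (x₀² + x₁²) e₂`, `P(x) = 4 x₂` -/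

/-- `e₂`. -/
def e2 : E3 := EuclideanSpace.single 2 (1 : ℝ)

/-- Coordinate functionals. -/
def pr (i : Fin 3) : E3 →L[ℝ] ℝ := EuclideanSpace.proj i

@[simp] theorem pr_apply (i : Fin 3) (x : E3) : pr i x = x i := rfl

theorem hasFDerivAt_coord (i : Fin 3) (x : E3) : HasFDerivAt (fun y : E3 => y i) (pr i) x :=
  (EuclideanSpace.proj i : E3 →L[ℝ] ℝ).hasFDerivAt

theorem contDiff_coord {n : WithTop ℕ∞} (i : Fin 3) : ContDiff ℝ n (fun y : E3 => y i) :=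
  (EuclideanSpace.proj i : E3 →L[ℝ] ℝ).contDiff

/-- The jet `U(x) = (x₀² + x₁²) e₂`. -/
def jetU (x : E3) : E3 := (x 0 * x 0 + x 1 * x 1) • e2

/-- Its pressure for viscosity `1`: `P(x) = 4 x₂`. -/
def jetP (x : E3) : ℝ := 4 * x 2

/-- The derivative `DU(x) h = 2(x₀h₀ + x₁h₁) e₂`, written as the product rule delivers it. -/
def jetU' (x : E3) : E3 →L[ℝ] E3 :=
  ((x 0 • pr 0 + x 0 • pr 0) + (x 1 • pr 1 + x 1 • pr 1)).smulRight e2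

theorem jetU'_apply (x h : E3) :
    jetU' x h = (x 0 * h 0 + x 0 * h 0 + (x 1 * h 1 + x 1 * h 1)) • e2 := by
  simp [jetU', ContinuousLinearMap.smulRight_apply]

theorem hasFDerivAt_jetU (x : E3) : HasFDerivAt jetU (jetU' x) x :=
  (((hasFDerivAt_coord 0 x).mul (hasFDerivAt_coord 0 x)).add
    ((hasFDerivAt_coord 1 x).mul (hasFDerivAt_coord 1 x))).smul_const e2

theorem fderiv_jetU (x : E3) : fderiv ℝ jetU x = jetU' x := (hasFDerivAt_jetU x).fderiv

theorem jetU_contDiff {n : WithTop ℕ∞} : ContDiff ℝ n jetU :=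
  (((contDiff_coord 0).mul (contDiff_coord 0)).add
    ((contDiff_coord 1).mul (contDiff_coord 1))).smul contDiff_const

theorem jetP_contDiff {n : WithTop ℕ∞} : ContDiff ℝ n jetP :=
  contDiff_const.mul (contDiff_coord 2)

@[simp] theorem e2_apply (i : Fin 3) : e2 i = if i = 2 then 1 else 0 := by
  simp [e2, PiLp.single_apply]

theorem jetU_apply (x : E3) (i : Fin 3) :
    jetU x i = if i = 2 then x 0 * x 0 + x 1 * x 1 else 0 := by
  simp [jetU]

/-- `(U·∇)U = 0` (the jet is independent of `x₂` and points along `e₂`). -/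
theorem convect_jetU (x : E3) : convect jetU jetU x = 0 := by
  rw [convect_apply, fderiv_jetU, jetU'_apply]
  simp [jetU_apply]

/-- `div U = 0`. -/
theorem divergence_jetU (x : E3) : VectorCalculus.divergence jetU x = 0 := by
  rw [divergence_eq_sum_inner_fderiv (EuclideanSpace.basisFun (Fin 3) ℝ), fderiv_jetU]
  simp [jetU'_apply, e2, EuclideanSpace.inner_single_right, inner_smul_right, PiLp.single_apply]

/-- The partial derivatives `y ↦ DU(y) eᵢ` are the linear maps `y ↦ 2 yᵢ [i < 2] e₂`. -/
theorem fderiv_jetU_basis (i : Fin 3) :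
    (fun y : E3 => fderiv ℝ jetU y (EuclideanSpace.basisFun (Fin 3) ℝ i)) =
      fun y => ((EuclideanSpace.single i (1 : ℝ) : E3) 0 * (y 0 + y 0) +
        (EuclideanSpace.single i (1 : ℝ) : E3) 1 * (y 1 + y 1)) • e2 := by
  funext y
  rw [fderiv_jetU, jetU'_apply, EuclideanSpace.basisFun_apply]
  congr 1
  ring

theorem hasFDerivAt_lin (a b : ℝ) (x : E3) :
    HasFDerivAt (fun y : E3 => (a * (y 0 + y 0) + b * (y 1 + y 1)) • e2)
      ((a • (pr 0 + pr 0) + b • (pr 1 + pr 1)).smulRight e2) x :=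
  ((((hasFDerivAt_coord 0 x).add (hasFDerivAt_coord 0 x)).const_mul a).add
    (((hasFDerivAt_coord 1 x).add (hasFDerivAt_coord 1 x)).const_mul b)).smul_const e2

/-- `ΔU = 4 e₂`. -/
theorem laplacian_jetU (x : E3) : (Δ jetU) x = (4 : ℝ) • e2 := by
  rw [laplacian_eq_sum_fderiv_fderiv (EuclideanSpace.basisFun (Fin 3) ℝ) (jetU_contDiff (n := 2)) x]
  simp_rw [fderiv_jetU_basis]
  rw [Fin.sum_univ_three, (hasFDerivAt_lin _ _ x).fderiv, (hasFDerivAt_lin _ _ x).fderiv,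
    (hasFDerivAt_lin _ _ x).fderiv]
  simp only [EuclideanSpace.basisFun_apply, ContinuousLinearMap.smulRight_apply, ← add_smul]
  congr 1
  simp
  norm_num

/-- `∇P = 4 e₂`. -/
theorem gradient_jetP (x : E3) : gradient jetP x = (4 : ℝ) • e2 := by
  have hf : HasFDerivAt jetP ((4 : ℝ) • pr 2) x := (hasFDerivAt_coord 2 x).const_mul 4
  have hP : HasFDerivAt jetP (InnerProductSpace.toDual ℝ E3 ((4 : ℝ) • e2)) x := by
    refine hf.congr_fderiv (ContinuousLinearMap.ext fun h => ?_)
    simp [e2, InnerProductSpace.toDual_apply_apply, EuclideanSpace.inner_single_left]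
  exact (hasGradientAt_iff_hasFDerivAt.mpr hP).gradient

/-- The steady momentum balance with viscosity `1` and zero force. -/
theorem momentum_jetU (x : E3) :
    convect jetU jetU x = (1 : ℝ) • (Δ jetU) x - gradient jetP x + (0 : E3 → E3) x := by
  rw [convect_jetU, laplacian_jetU, gradient_jetP]
  simp

/-- **The jet is a classical Navier–Stokes solution on `(−∞,0) × ℝ³`** (steady; tree
`IsClassicalNSSolutionOnRegion.of_steady` + the slab bridge). -/
theorem jet_isClassicalNSSolutionOn :
    IsClassicalNSSolutionOn (Iio (0 : ℝ)) 1 0 (fun _ => jetU) (fun _ => jetP) := by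
  have h := IsClassicalNSSolutionOnRegion.of_steady (ν := (1 : ℝ)) (F := (0 : E3 → E3))
    (D := (univ : Set E3)) jetU_contDiff.contDiffOn jetP_contDiff.contDiffOn
    (fun x _ => momentum_jetU x) (fun x _ => divergence_jetU x) (Iio (0 : ℝ))
  exact isClassicalNSSolutionOnRegion_prod_univ_iff.1 h

/-- **The jet's vorticity is tangent to every sphere about the origin**: `⟪x, curl U x⟫ = 0`
(`curl U = (2x₁, −2x₀, 0)` is azimuthal). -/
theorem inner_curl_jetU (x : E3) : ⟪x, curl jetU x⟫ = 0 := by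
  simp only [curl, fderiv_jetU, jetU'_apply, PiLp.inner_apply, Fin.sum_univ_three]
  simp [e2]
  ring

/-- The jet is unbounded (so the witness lies outside `IsBoundedAncientMildSolution`, as it must). -/
theorem jetU_unbounded : ¬ IsBoundedOn (Iio (0 : ℝ)) (fun _ : ℝ => jetU) := by
  rintro ⟨C, hC⟩
  have h := hC (-1) (by norm_num) ((C + 1) • EuclideanSpace.single 0 (1 : ℝ))
  have hle : (C + 1) * (C + 1) ≤ C := by
    have h2 := (PiLp.norm_apply_le (jetU ((C + 1) • EuclideanSpace.single 0 (1 : ℝ))) 2).trans h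
    simpa [jetU_apply, PiLp.single_apply, Real.norm_eq_abs, abs_mul_self] using h2
  nlinarith [sq_nonneg C]

/-- **`PoloidalLiouville` is false without boundedness.**  Witness: the free Poiseuille jet. -/
theorem poloidalLiouville_false_without_bounded : ¬ PoloidalLiouvilleWithoutBounded := by
  intro h
  have hmeas : ∀ t < (0 : ℝ), AEStronglyMeasurable ((fun _ : ℝ => jetU) t) volume :=
    fun t _ => jetU_contDiff (n := 0) |>.continuous.aestronglyMeasurable
  have hsm : ContDiffOn ℝ (⊤ : ℕ∞) (uncurry fun _ : ℝ => jetU) (Iio 0 ×ˢ univ) :=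
    (jetU_contDiff.comp contDiff_snd).contDiffOn
  have hun : ∃ x₀ : E3, ∀ t < (0 : ℝ), ∀ x, ⟪x - x₀, curl ((fun _ : ℝ => jetU) t) x⟫ = 0 :=
    ⟨0, fun t _ x => by rw [sub_zero]; exact inner_curl_jetU x⟩
  obtain ⟨b, hb⟩ := h _ _ jet_isClassicalNSSolutionOn hmeas hsm hun (-1) (by norm_num)
  have h0 : jetU 0 = b := hb 0
  have h1 : jetU (EuclideanSpace.single 0 (1 : ℝ)) = b := hb _
  have h2 : jetU (EuclideanSpace.single 0 (1 : ℝ)) 2 = jetU 0 2 := by rw [h0, h1]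
  simp [jetU_apply] at h2

end Summit.NavierStokesRegularity.NavierStokesRegularity.Cruxes.PoloidalLiouville.SilentShells
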